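import Summits.SmoothPoincare4.SmoothPoincare4.Theses.SymplecticOrigami
import Summits.SmoothPoincare4.SmoothPoincare4.Theses.SymplecticCap
import Summits.SmoothPoincare4.SmoothPoincare4.Theorems.SymplecticOrigamiGromovRecognitionRelEndStubCapModelAux2
import Literature.Geometry.Symplectic.AlmostComplexStructure
import Literature.Geometry.Symplectic.GromovR4RelEnd

/-!
# Stub `stub_wedgeDisjoint` of line `cross-cap-laurent` — the wedge of the cap is a wedge
(crux `GromovRecognitionRelEnd`, item stmt-SmoothPoincare4-11009)

In a cap block (output of `stub_capModel`: the end of `M` capped by the two spheres at infinity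
`H∞ = {z₂ = ∞}`, `V∞ = {z₁ = ∞}` through the cap charts `ηV (u, z₂) = ι χ (1/u, z₂)`,
`ηH (z₁, t) = ι χ (z₁, 1/t)`, `ηC (u, t) = ηV (u, 1/t) = ηH (1/u, t)`), the affine parts
`ηH (ℂ × 0)`, `ηV (0 × ℂ)` of the two spheres are disjoint and miss the corner `ηC 0`.

The proof is topological. If `ηH p = ηV q` (`p, q` axis points) then, `ηV` being a local
homeomorphism near `q`, `ηV W` is a neighbourhood of `ηH p` for every neighbourhood `W` of `q`; by
continuity of `ηH` the points `p_t = (p₀, p₁, t, 0)`, `t ≠ 0` small, satisfy `ηH p_t = ηV q'`,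
`q' ∈ W`. But `ηH p_t = ι χ (p₀, p₁, 1/t) ∈ ι(M)`, so `q'` is off the axis and
`ηV q' = ι χ (1/u, q'₂, q'₃)`, `u = (q'₀, q'₁)`; injectivity of `ι` and of `χ` beyond `R` (it
inverts `ψ` there, H8/H9) forces `(p₀, p₁) = 1/u`, i.e. `|p|² |u|² = 1` — impossible for `W`
inside `{|p|² |u|² < 1}`. The corner statements are the same argument through the corner chart,
once we know that only points off both axes of the corner polydisc are mapped into `ι(M)`.
-/

noncomputable section

-- the prescribed namespace `Summit.<P>.<Sub>.…` duplicates `SmoothPoincare4` (P = Sub)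
set_option linter.dupNamespace false

open scoped Manifold ContDiff Topology
open Set Filter TopologicalSpace Literature.Geometry.Kaehler Literature.Geometry.Symplectic

namespace Summit.SmoothPoincare4.SmoothPoincare4.Theorems.GromovRecognitionRelEnd.CrossCapLaurent

/-- Model space `ℝ⁴ = ℂ²` (coordinates `0,1` = `z₁`, `2,3` = `z₂`). -/
local notation "E4" => EuclideanSpace ℝ (Fin 4)

namespace CapModel

/-! ## Two elementary steps -/

/-- **The local-homeomorphism step.** If `g` is a local homeomorphism on `D ∋ q`, `W` is a
neighbourhood of `q` and the path `γ` is continuous at `0` with `γ 0 = g q`, then `γ t = g q'` for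
some `t ≠ 0` with `t² < R₁⁻²` and some `q' ∈ W` (as `g '' W` is a neighbourhood of `g q`).
[folklore] -/
theorem exists_ne_zero_apply_eq {X : Type*} [TopologicalSpace X] {g : E4 → X} {D W : Set E4}
    (hg : IsLocalHomeomorphOn g D) {q : E4} (hq : q ∈ D) (hW : W ∈ 𝓝 q) {γ : ℝ → X}
    (hγ : ContinuousAt γ 0) (h0 : γ 0 = g q) {R₁ : ℝ} (hR₁ : 0 < R₁) :
    ∃ t : ℝ, t ≠ 0 ∧ t ^ 2 < R₁⁻¹ ^ 2 ∧ ∃ q' ∈ W, g q' = γ t := by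
  have hN : g '' W ∈ 𝓝 (γ 0) := by
    rw [h0, ← hg.map_nhds_eq hq]
    exact image_mem_map hW
  have h1 : ∀ᶠ t in 𝓝 (0 : ℝ), γ t ∈ g '' W := hγ.preimage_mem_nhds hN
  have h2 : ∀ᶠ t in 𝓝 (0 : ℝ), t ^ 2 < R₁⁻¹ ^ 2 := by
    have hc : Continuous fun t : ℝ => t ^ 2 := continuous_pow 2
    have h00 : (0 : ℝ) ^ 2 < R₁⁻¹ ^ 2 := by rw [zero_pow two_ne_zero]; positivity
    exact hc.continuousAt.eventually_lt continuousAt_const h00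
  haveI : (𝓝[≠] (0 : ℝ)).NeBot := NormedField.nhdsNE_neBot 0
  have h3 : ∀ᶠ t in 𝓝[≠] (0 : ℝ), t ≠ 0 := self_mem_nhdsWithin
  exact (h3.and ((h2.and h1).filter_mono nhdsWithin_le_nhds)).exists

/-- **The corner chart versus `ι(M)`.** By the gluing clauses of the corner chart (`ηC = ηV ∘ inv2`
off the `z₂`-axis, `ηC = ηH ∘ inv1` off the `z₁`-axis, `ηC 0` new) and the axis clauses of `ηV`,
`ηH`, a point of the corner polydisc mapped into `ι(M)` is off both axes. [folklore] -/
theorem r1_ne_zero_and_r2_ne_zero_of_mem_range {M X : Type*} {ι : M → X} {ηH ηV ηC : E4 → X}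
    {R₁ : ℝ}
    (hVaxis : ∀ p : E4, p 0 = 0 → p 1 = 0 → ηV p ∉ Set.range ι)
    (hHaxis : ∀ p : E4, p 2 = 0 → p 3 = 0 → ηH p ∉ Set.range ι)
    (hCV : ∀ p : E4, r1 p < R₁⁻¹ ^ 2 → r2 p < R₁⁻¹ ^ 2 → (p 2 ≠ 0 ∨ p 3 ≠ 0) →
      ηC p = ηV (inv2 p))
    (hCH : ∀ p : E4, r1 p < R₁⁻¹ ^ 2 → r2 p < R₁⁻¹ ^ 2 → (p 0 ≠ 0 ∨ p 1 ≠ 0) →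
      ηC p = ηH (inv1 p))
    (hC0 : ηC 0 ∉ Set.range ι) {c : E4} (hc1 : r1 c < R₁⁻¹ ^ 2) (hc2 : r2 c < R₁⁻¹ ^ 2)
    (hc : ηC c ∈ Set.range ι) : r1 c ≠ 0 ∧ r2 c ≠ 0 := by
  by_cases h1 : r1 c = 0
  · exfalso
    obtain ⟨h00, h11⟩ := (r1_eq_zero_iff c).1 h1
    by_cases h2 : r2 c = 0
    · obtain ⟨h22, h33⟩ := (r2_eq_zero_iff c).1 h2
      have hc0 : c = 0 := by
        ext i; fin_cases i <;> simp [h00, h11, h22, h33]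
      rw [hc0] at hc
      exact hC0 hc
    · rw [hCV c hc1 hc2 ((r2_ne_zero_iff c).1 h2)] at hc
      exact hVaxis (inv2 c) (by simp [h00]) (by simp [h11]) hc
  · refine ⟨h1, fun h2 => ?_⟩
    obtain ⟨h22, h33⟩ := (r2_eq_zero_iff c).1 h2
    rw [hCH c hc1 hc2 ((r1_ne_zero_iff c).1 h1)] at hc
    exact hHaxis (inv1 c) (by simp [h22]) (by simp [h33]) hc

/-! ## The three incidences -/

/-- **`H∞` and `V∞` have disjoint affine parts**: `ηH (z₁, 0) ≠ ηV (0, z₂)` (see the module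
docstring for the argument). [folklore] -/
theorem ηH_ne_ηV {M X : Type*} [TopologicalSpace X] {ι : M → X} {χ : E4 → M}
    {ηH ηV : E4 → X} {R R₁ : ℝ} (hR : R < R₁) (hR₁ : 0 < R₁)
    (hχ : ∀ w w' : E4, R < ‖w‖ → R < ‖w'‖ → χ w = χ w' → w = w')
    (hι : Function.Injective ι)
    (hVloc : IsLocalHomeomorphOn ηV {p | r1 p < R₁⁻¹ ^ 2})
    (hVcap : ∀ p : E4, r1 p < R₁⁻¹ ^ 2 → (p 0 ≠ 0 ∨ p 1 ≠ 0) → ηV p = ι (χ (inv1 p)))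
    (hVaxis : ∀ p : E4, p 0 = 0 → p 1 = 0 → ηV p ∉ Set.range ι)
    (hHloc : IsLocalHomeomorphOn ηH {p | r2 p < R₁⁻¹ ^ 2})
    (hHcap : ∀ p : E4, r2 p < R₁⁻¹ ^ 2 → (p 2 ≠ 0 ∨ p 3 ≠ 0) → ηH p = ι (χ (inv2 p)))
    {p q : E4} (hp2 : p 2 = 0) (hp3 : p 3 = 0) (hq0 : q 0 = 0) (hq1 : q 1 = 0) :
    ηH p ≠ ηV q := by
  intro heq
  have hR₁' : (0 : ℝ) < R₁⁻¹ ^ 2 := by positivity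
  have hpD : r2 p < R₁⁻¹ ^ 2 := by rw [r2_def, hp2, hp3]; simpa using hR₁'
  have hqD : r1 q < R₁⁻¹ ^ 2 := by rw [r1_def, hq0, hq1]; simpa using hR₁'
  have hp0 : (WithLp.toLp 2 ![p 0, p 1, 0, 0] : E4) = p := by
    ext i; fin_cases i <;> simp [hp2, hp3]
  -- the path `γ t = ηH (p₀, p₁, t, 0)` is continuous at `0`, `γ 0 = ηH p = ηV q`
  have hγ : ContinuousAt (fun t : ℝ => ηH (WithLp.toLp 2 ![p 0, p 1, t, 0])) 0 := by
    have hc : Continuous (fun t : ℝ => (WithLp.toLp 2 ![p 0, p 1, t, 0] : E4)) := by fun_prop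
    have h1 : ContinuousAt ηH (WithLp.toLp 2 ![p 0, p 1, (0 : ℝ), 0]) := by
      rw [hp0]; exact hHloc.continuousAt hpD
    exact ContinuousAt.comp (f := fun t : ℝ => (WithLp.toLp 2 ![p 0, p 1, t, 0] : E4)) (x := 0)
      h1 hc.continuousAt
  have hγ0 : (fun t : ℝ => ηH (WithLp.toLp 2 ![p 0, p 1, t, 0])) 0 = ηV q := by
    show ηH _ = _; rw [hp0]; exact heq
  -- the neighbourhood `W = {|u| < R₁⁻¹, |p|²|u|² < 1}` of `q`
  have hW : {q' : E4 | r1 q' < R₁⁻¹ ^ 2 ∧ r1 p * r1 q' < 1} ∈ 𝓝 q := by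
    refine IsOpen.mem_nhds ?_ ⟨hqD, ?_⟩
    · exact (isOpen_lt continuous_r1 continuous_const).and
        (isOpen_lt (continuous_const.mul continuous_r1) continuous_const)
    · have : r1 q = 0 := by rw [r1_def, hq0, hq1]; ring
      rw [this, mul_zero]; exact one_pos
  obtain ⟨t, ht0, ht, q', ⟨hq'D, hq'W⟩, hq'⟩ := exists_ne_zero_apply_eq hVloc hqD hW hγ hγ0 hR₁
  set pt : E4 := WithLp.toLp 2 ![p 0, p 1, t, 0] with hpt
  have hq'' : ηV q' = ηH pt := hq'
  have hr1pt : r1 pt = r1 p := by simp [hpt, r1_def]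
  have hr2pt : r2 pt = t ^ 2 := by simp [hpt, r2_def]
  have hr2pt' : r2 pt < R₁⁻¹ ^ 2 := by rw [hr2pt]; exact ht
  have hr2pt0 : r2 pt ≠ 0 := by rw [hr2pt]; positivity
  have hHt : ηH pt = ι (χ (inv2 pt)) := hHcap pt hr2pt' ((r2_ne_zero_iff pt).1 hr2pt0)
  -- `q'` is off the axis, as `ηV q' = ηH pt ∈ ι(M)`
  have hq'ax : q' 0 ≠ 0 ∨ q' 1 ≠ 0 := by
    by_contra h
    push Not at h
    exact hVaxis q' h.1 h.2 ⟨χ (inv2 pt), by rw [hq'', hHt]⟩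
  have hr1q' : r1 q' ≠ 0 := (r1_ne_zero_iff q').2 hq'ax
  have hVq' : ηV q' = ι (χ (inv1 q')) := hVcap q' hq'D hq'ax
  -- injectivity of `ι`, then of `χ` beyond `R`
  have h1 : χ (inv1 q') = χ (inv2 pt) := hι (hVq'.symm.trans (hq''.trans hHt))
  have hn1 : R < ‖inv1 q'‖ := hR.trans (lt_norm_of_sq_lt_r1 (sq_lt_r1_inv1 hr1q' hq'D))
  have hn2 : R < ‖inv2 pt‖ := hR.trans (lt_norm_of_sq_lt_r2 (sq_lt_r2_inv2 hr2pt0 hr2pt'))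
  have h2 : inv1 q' = inv2 pt := hχ _ _ hn1 hn2 h1
  have h3 : (r1 q')⁻¹ = r1 p := by
    simpa only [r1_inv1, r1_inv2, hr1pt] using congrArg r1 h2
  have h4 : r1 p * r1 q' = 1 := by rw [← h3, inv_mul_cancel₀ hr1q']
  linarith

/-- **The affine part of `H∞` misses the corner**: `ηH (z₁, 0) ≠ ηC 0`. Same argument through the
corner chart: `ηH p_t = ηC c` with `c` small; `c` is off both axes
(`r1_ne_zero_and_r2_ne_zero_of_mem_range`), so `ηC c = ηV (inv2 c) = ι χ (inv1 (inv2 c))` and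
injectivity gives `|p|² |c₁|² = 1`. [folklore] -/
theorem ηH_ne_ηC_zero {M X : Type*} [TopologicalSpace X] {ι : M → X} {χ : E4 → M}
    {ηH ηV ηC : E4 → X} {R R₁ : ℝ} (hR : R < R₁) (hR₁ : 0 < R₁)
    (hχ : ∀ w w' : E4, R < ‖w‖ → R < ‖w'‖ → χ w = χ w' → w = w')
    (hι : Function.Injective ι)
    (hVcap : ∀ p : E4, r1 p < R₁⁻¹ ^ 2 → (p 0 ≠ 0 ∨ p 1 ≠ 0) → ηV p = ι (χ (inv1 p)))
    (hVaxis : ∀ p : E4, p 0 = 0 → p 1 = 0 → ηV p ∉ Set.range ι)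
    (hHloc : IsLocalHomeomorphOn ηH {p | r2 p < R₁⁻¹ ^ 2})
    (hHcap : ∀ p : E4, r2 p < R₁⁻¹ ^ 2 → (p 2 ≠ 0 ∨ p 3 ≠ 0) → ηH p = ι (χ (inv2 p)))
    (hHaxis : ∀ p : E4, p 2 = 0 → p 3 = 0 → ηH p ∉ Set.range ι)
    (hCloc : IsLocalHomeomorphOn ηC {p | r1 p < R₁⁻¹ ^ 2 ∧ r2 p < R₁⁻¹ ^ 2})
    (hCV : ∀ p : E4, r1 p < R₁⁻¹ ^ 2 → r2 p < R₁⁻¹ ^ 2 → (p 2 ≠ 0 ∨ p 3 ≠ 0) →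
      ηC p = ηV (inv2 p))
    (hCH : ∀ p : E4, r1 p < R₁⁻¹ ^ 2 → r2 p < R₁⁻¹ ^ 2 → (p 0 ≠ 0 ∨ p 1 ≠ 0) →
      ηC p = ηH (inv1 p))
    (hC0 : ηC 0 ∉ Set.range ι) {p : E4} (hp2 : p 2 = 0) (hp3 : p 3 = 0) :
    ηH p ≠ ηC 0 := by
  intro heq
  have hR₁' : (0 : ℝ) < R₁⁻¹ ^ 2 := by positivity
  have hpD : r2 p < R₁⁻¹ ^ 2 := by rw [r2_def, hp2, hp3]; simpa using hR₁'
  have h0D : (0 : E4) ∈ {c : E4 | r1 c < R₁⁻¹ ^ 2 ∧ r2 c < R₁⁻¹ ^ 2} := by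
    constructor
    · simpa [r1_def] using hR₁'
    · simpa [r2_def] using hR₁'
  have hp0 : (WithLp.toLp 2 ![p 0, p 1, 0, 0] : E4) = p := by
    ext i; fin_cases i <;> simp [hp2, hp3]
  have hγ : ContinuousAt (fun t : ℝ => ηH (WithLp.toLp 2 ![p 0, p 1, t, 0])) 0 := by
    have hc : Continuous (fun t : ℝ => (WithLp.toLp 2 ![p 0, p 1, t, 0] : E4)) := by fun_prop
    have h1 : ContinuousAt ηH (WithLp.toLp 2 ![p 0, p 1, (0 : ℝ), 0]) := by
      rw [hp0]; exact hHloc.continuousAt hpD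
    exact ContinuousAt.comp (f := fun t : ℝ => (WithLp.toLp 2 ![p 0, p 1, t, 0] : E4)) (x := 0)
      h1 hc.continuousAt
  have hγ0 : (fun t : ℝ => ηH (WithLp.toLp 2 ![p 0, p 1, t, 0])) 0 = ηC 0 := by
    show ηH _ = _; rw [hp0]; exact heq
  have hW : {c : E4 | (r1 c < R₁⁻¹ ^ 2 ∧ r2 c < R₁⁻¹ ^ 2) ∧ r1 p * r1 c < 1} ∈ 𝓝 (0 : E4) := by
    refine IsOpen.mem_nhds ?_ ⟨h0D, ?_⟩
    · exact ((isOpen_lt continuous_r1 continuous_const).and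
        (isOpen_lt continuous_r2 continuous_const)).and
        (isOpen_lt (continuous_const.mul continuous_r1) continuous_const)
    · have : r1 (0 : E4) = 0 := by simp [r1_def]
      rw [this, mul_zero]; exact one_pos
  obtain ⟨t, ht0, ht, c, ⟨⟨hc1, hc2⟩, hcW⟩, hc⟩ :=
    exists_ne_zero_apply_eq hCloc h0D hW hγ hγ0 hR₁
  set pt : E4 := WithLp.toLp 2 ![p 0, p 1, t, 0] with hpt
  have hc' : ηC c = ηH pt := hc
  have hr1pt : r1 pt = r1 p := by simp [hpt, r1_def]
  have hr2pt : r2 pt = t ^ 2 := by simp [hpt, r2_def]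
  have hr2pt' : r2 pt < R₁⁻¹ ^ 2 := by rw [hr2pt]; exact ht
  have hr2pt0 : r2 pt ≠ 0 := by rw [hr2pt]; positivity
  have hHt : ηH pt = ι (χ (inv2 pt)) := hHcap pt hr2pt' ((r2_ne_zero_iff pt).1 hr2pt0)
  have hcr : ηC c ∈ Set.range ι := ⟨χ (inv2 pt), by rw [hc', hHt]⟩
  obtain ⟨hr1c, hr2c⟩ :=
    r1_ne_zero_and_r2_ne_zero_of_mem_range hVaxis hHaxis hCV hCH hC0 hc1 hc2 hcr
  -- `ηC c = ηV (inv2 c) = ι χ (inv1 (inv2 c))`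
  have e1 : ηC c = ηV (inv2 c) := hCV c hc1 hc2 ((r2_ne_zero_iff c).1 hr2c)
  have hD' : r1 (inv2 c) < R₁⁻¹ ^ 2 := by rw [r1_inv2]; exact hc1
  have h0' : r1 (inv2 c) ≠ 0 := by rw [r1_inv2]; exact hr1c
  have e2 : ηV (inv2 c) = ι (χ (inv1 (inv2 c))) :=
    hVcap (inv2 c) hD' ((r1_ne_zero_iff _).1 h0')
  have h1 : χ (inv1 (inv2 c)) = χ (inv2 pt) :=
    hι (e2.symm.trans (e1.symm.trans (hc'.trans hHt)))
  have hn1 : R < ‖inv1 (inv2 c)‖ := hR.trans (lt_norm_of_sq_lt_r1 (sq_lt_r1_inv1 h0' hD'))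
  have hn2 : R < ‖inv2 pt‖ := hR.trans (lt_norm_of_sq_lt_r2 (sq_lt_r2_inv2 hr2pt0 hr2pt'))
  have h2 : inv1 (inv2 c) = inv2 pt := hχ _ _ hn1 hn2 h1
  have h3 : (r1 c)⁻¹ = r1 p := by
    simpa only [r1_inv1, r1_inv2, hr1pt] using congrArg r1 h2
  have h4 : r1 p * r1 c = 1 := by rw [← h3, inv_mul_cancel₀ hr1c]
  linarith

/-- **The affine part of `V∞` misses the corner**: `ηV (0, z₂) ≠ ηC 0` (the mirror image of
`ηH_ne_ηC_zero`: path `q_t = (t, 0, q₂, q₃)`, `ηC c = ηH (inv1 c) = ι χ (inv2 (inv1 c))`,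
`|q|² |c₂|² = 1`). [folklore] -/
theorem ηV_ne_ηC_zero {M X : Type*} [TopologicalSpace X] {ι : M → X} {χ : E4 → M}
    {ηH ηV ηC : E4 → X} {R R₁ : ℝ} (hR : R < R₁) (hR₁ : 0 < R₁)
    (hχ : ∀ w w' : E4, R < ‖w‖ → R < ‖w'‖ → χ w = χ w' → w = w')
    (hι : Function.Injective ι)
    (hVloc : IsLocalHomeomorphOn ηV {p | r1 p < R₁⁻¹ ^ 2})
    (hVcap : ∀ p : E4, r1 p < R₁⁻¹ ^ 2 → (p 0 ≠ 0 ∨ p 1 ≠ 0) → ηV p = ι (χ (inv1 p)))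
    (hVaxis : ∀ p : E4, p 0 = 0 → p 1 = 0 → ηV p ∉ Set.range ι)
    (hHcap : ∀ p : E4, r2 p < R₁⁻¹ ^ 2 → (p 2 ≠ 0 ∨ p 3 ≠ 0) → ηH p = ι (χ (inv2 p)))
    (hHaxis : ∀ p : E4, p 2 = 0 → p 3 = 0 → ηH p ∉ Set.range ι)
    (hCloc : IsLocalHomeomorphOn ηC {p | r1 p < R₁⁻¹ ^ 2 ∧ r2 p < R₁⁻¹ ^ 2})
    (hCV : ∀ p : E4, r1 p < R₁⁻¹ ^ 2 → r2 p < R₁⁻¹ ^ 2 → (p 2 ≠ 0 ∨ p 3 ≠ 0) →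
      ηC p = ηV (inv2 p))
    (hCH : ∀ p : E4, r1 p < R₁⁻¹ ^ 2 → r2 p < R₁⁻¹ ^ 2 → (p 0 ≠ 0 ∨ p 1 ≠ 0) →
      ηC p = ηH (inv1 p))
    (hC0 : ηC 0 ∉ Set.range ι) {q : E4} (hq0 : q 0 = 0) (hq1 : q 1 = 0) :
    ηV q ≠ ηC 0 := by
  intro heq
  have hR₁' : (0 : ℝ) < R₁⁻¹ ^ 2 := by positivity
  have hqD : r1 q < R₁⁻¹ ^ 2 := by rw [r1_def, hq0, hq1]; simpa using hR₁'
  have h0D : (0 : E4) ∈ {c : E4 | r1 c < R₁⁻¹ ^ 2 ∧ r2 c < R₁⁻¹ ^ 2} := by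
    constructor
    · simpa [r1_def] using hR₁'
    · simpa [r2_def] using hR₁'
  have hq0' : (WithLp.toLp 2 ![0, 0, q 2, q 3] : E4) = q := by
    ext i; fin_cases i <;> simp [hq0, hq1]
  have hγ : ContinuousAt (fun t : ℝ => ηV (WithLp.toLp 2 ![t, 0, q 2, q 3])) 0 := by
    have hc : Continuous (fun t : ℝ => (WithLp.toLp 2 ![t, 0, q 2, q 3] : E4)) := by fun_prop
    have h1 : ContinuousAt ηV (WithLp.toLp 2 ![(0 : ℝ), 0, q 2, q 3]) := by
      rw [hq0']; exact hVloc.continuousAt hqD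
    exact ContinuousAt.comp (f := fun t : ℝ => (WithLp.toLp 2 ![t, 0, q 2, q 3] : E4)) (x := 0)
      h1 hc.continuousAt
  have hγ0 : (fun t : ℝ => ηV (WithLp.toLp 2 ![t, 0, q 2, q 3])) 0 = ηC 0 := by
    show ηV _ = _; rw [hq0']; exact heq
  have hW : {c : E4 | (r1 c < R₁⁻¹ ^ 2 ∧ r2 c < R₁⁻¹ ^ 2) ∧ r2 q * r2 c < 1} ∈ 𝓝 (0 : E4) := by
    refine IsOpen.mem_nhds ?_ ⟨h0D, ?_⟩
    · exact ((isOpen_lt continuous_r1 continuous_const).and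
        (isOpen_lt continuous_r2 continuous_const)).and
        (isOpen_lt (continuous_const.mul continuous_r2) continuous_const)
    · have : r2 (0 : E4) = 0 := by simp [r2_def]
      rw [this, mul_zero]; exact one_pos
  obtain ⟨t, ht0, ht, c, ⟨⟨hc1, hc2⟩, hcW⟩, hc⟩ :=
    exists_ne_zero_apply_eq hCloc h0D hW hγ hγ0 hR₁
  set qt : E4 := WithLp.toLp 2 ![t, 0, q 2, q 3] with hqt
  have hc' : ηC c = ηV qt := hc
  have hr2qt : r2 qt = r2 q := by simp [hqt, r2_def]
  have hr1qt : r1 qt = t ^ 2 := by simp [hqt, r1_def]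
  have hr1qt' : r1 qt < R₁⁻¹ ^ 2 := by rw [hr1qt]; exact ht
  have hr1qt0 : r1 qt ≠ 0 := by rw [hr1qt]; positivity
  have hVt : ηV qt = ι (χ (inv1 qt)) := hVcap qt hr1qt' ((r1_ne_zero_iff qt).1 hr1qt0)
  have hcr : ηC c ∈ Set.range ι := ⟨χ (inv1 qt), by rw [hc', hVt]⟩
  obtain ⟨hr1c, hr2c⟩ :=
    r1_ne_zero_and_r2_ne_zero_of_mem_range hVaxis hHaxis hCV hCH hC0 hc1 hc2 hcr
  -- `ηC c = ηH (inv1 c) = ι χ (inv2 (inv1 c))`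
  have e1 : ηC c = ηH (inv1 c) := hCH c hc1 hc2 ((r1_ne_zero_iff c).1 hr1c)
  have hD' : r2 (inv1 c) < R₁⁻¹ ^ 2 := by rw [r2_inv1]; exact hc2
  have h0' : r2 (inv1 c) ≠ 0 := by rw [r2_inv1]; exact hr2c
  have e2 : ηH (inv1 c) = ι (χ (inv2 (inv1 c))) :=
    hHcap (inv1 c) hD' ((r2_ne_zero_iff _).1 h0')
  have h1 : χ (inv2 (inv1 c)) = χ (inv1 qt) :=
    hι (e2.symm.trans (e1.symm.trans (hc'.trans hVt)))
  have hn1 : R < ‖inv2 (inv1 c)‖ := hR.trans (lt_norm_of_sq_lt_r2 (sq_lt_r2_inv2 h0' hD'))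
  have hn2 : R < ‖inv1 qt‖ := hR.trans (lt_norm_of_sq_lt_r1 (sq_lt_r1_inv1 hr1qt0 hr1qt'))
  have h2 : inv2 (inv1 c) = inv1 qt := hχ _ _ hn1 hn2 h1
  have h3 : (r2 c)⁻¹ = r2 q := by
    simpa only [r2_inv2, r2_inv1, hr2qt] using congrArg r2 h2
  have h4 : r2 q * r2 c = 1 := by rw [← h3, inv_mul_cancel₀ hr2c]
  linarith

end CapModel

/-! ## The registered statement -/

/-- **Stub 4a — the wedge is a wedge (S mathematically / M formally).**  In any cap block as output by
`stub_capModel`, the affine parts of the two spheres at infinity, `ηH {p₂ = p₃ = 0}` and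
`ηV {q₀ = q₁ = 0}`, are disjoint and do not contain the corner `ηC 0`; i.e. `H∞ ∩ V∞ = {ηC 0}` with
`H∞ := ηH(ℂ × 0) ∪ {ηC 0}`, `V∞ := ηV(0 × ℂ) ∪ {ηC 0}`.  Proof plan: if `ηH p = ηV q =: y` (axis points),
`ηV` restricted to a small ball `W ∋ q` inside `{q₀² + q₁² < δ²}` is a homeomorphism onto an open `N ∋ y`
(`IsLocalDiffeomorphOn` at `q`); `ηH⁻¹ N` is a neighbourhood of `p`, so contains `p' = (p₀, p₁, t)` with
`0 < |t|` small, and `ηH p' = ι χ (p₀, p₁, 1/t) ∈ range ι ∩ N = ηV (W ∖ axis)`, `= ι χ (1/u, q₂', q₃')` with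
`0 < |u| < δ`; injectivity of `ι` (cap block) and of `χ` on `{R < ‖w‖}` (`χ = ψ⁻¹` there, from H8/H9) gives
`(p₀, p₁) = 1/u`, absurd for `δ⁻¹ > |(p₀,p₁)|`.  The corner cases are the same with `ηC (u, t) = ηH (1/u, t)`
/ `= ηV (u, 1/t)`.  Leans on: cap block clauses only (+ H8, H9, `R < R₁`, `0 < R₁`); Mathlib
`IsLocalDiffeomorphOn`, `OpenPartialHomeomorph`. [folklore] -/
theorem stub_wedgeDisjoint :
    ∀ (M : Type) [TopologicalSpace M] [T2Space M] [SecondCountableTopology M]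
      [ChartedSpace E4 M] [IsManifold (𝓡 4) ∞ M] [ConnectedSpace M]
      (J : AlmostComplexStructure (𝓡 4) ∞ M) (K : Set M) (R R₁ : ℝ) (ψ : M → E4) (χ : E4 → M),
      ContMDiffOn (𝓡 4) 𝓘(ℝ, E4) ∞ ψ Kᶜ →
      ContMDiffOn 𝓘(ℝ, E4) (𝓡 4) ∞ χ (Metric.closedBall (0 : E4) R)ᶜ →
      Set.BijOn ψ Kᶜ (Metric.closedBall (0 : E4) R)ᶜ →
      (∀ x, x ∈ Kᶜ → χ (ψ x) = x) →
      R < R₁ → 0 < R₁ →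
      (∀ x, x ∈ Kᶜ → R₁ < ‖ψ x‖ → ∀ (v : TangentSpace (𝓡 4) x) (a : E4),
          a = mfderiv (𝓡 4) 𝓘(ℝ, E4) ψ x v →
          mfderiv (𝓡 4) 𝓘(ℝ, E4) ψ x (J x v) = WithLp.toLp 2 ![-(a 1), a 0, -(a 3), a 2]) →
      ∀ (X : Type) [TopologicalSpace X] [T2Space X] [SecondCountableTopology X] [CompactSpace X]
        [ConnectedSpace X] [ChartedSpace E4 X] [IsManifold (𝓡 4) ∞ X]
        (ωX : MForm (𝓡 4) X ℝ 2) (JX : AlmostComplexStructure (𝓡 4) ∞ X) (ι : M → X)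
        (ηH ηV ηC : E4 → X),
        (IsSmoothForm ωX ∧ IsClosedForm ωX ∧ JX.IsTamedBy ωX) ∧
        (IsLocalDiffeomorph (𝓡 4) (𝓡 4) ∞ ι ∧ Function.Injective ι ∧
          ∀ (x : M) (v : TangentSpace (𝓡 4) x),
            JX (ι x) (mfderiv (𝓡 4) (𝓡 4) ι x v) = mfderiv (𝓡 4) (𝓡 4) ι x (J x v)) ∧
        (IsLocalDiffeomorphOn 𝓘(ℝ, E4) (𝓡 4) ∞ ηV {p : E4 | p 0 ^ 2 + p 1 ^ 2 < R₁⁻¹ ^ 2} ∧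
          Set.InjOn ηV {p : E4 | p 0 ^ 2 + p 1 ^ 2 < R₁⁻¹ ^ 2} ∧
          (∀ p : E4, p 0 ^ 2 + p 1 ^ 2 < R₁⁻¹ ^ 2 → (p 0 ≠ 0 ∨ p 1 ≠ 0) →
            ηV p = ι (χ (WithLp.toLp 2
              ![p 0 / (p 0 ^ 2 + p 1 ^ 2), -(p 1) / (p 0 ^ 2 + p 1 ^ 2), p 2, p 3]))) ∧
          (∀ p : E4, p 0 = 0 → p 1 = 0 → ηV p ∉ Set.range ι) ∧
          (∀ p : E4, p 0 ^ 2 + p 1 ^ 2 < R₁⁻¹ ^ 2 → ∀ q : E4,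
            JX (ηV p) (mfderiv 𝓘(ℝ, E4) (𝓡 4) ηV p q) =
              mfderiv 𝓘(ℝ, E4) (𝓡 4) ηV p (WithLp.toLp 2 ![-(q 1), q 0, -(q 3), q 2]))) ∧
        (IsLocalDiffeomorphOn 𝓘(ℝ, E4) (𝓡 4) ∞ ηH {p : E4 | p 2 ^ 2 + p 3 ^ 2 < R₁⁻¹ ^ 2} ∧
          Set.InjOn ηH {p : E4 | p 2 ^ 2 + p 3 ^ 2 < R₁⁻¹ ^ 2} ∧
          (∀ p : E4, p 2 ^ 2 + p 3 ^ 2 < R₁⁻¹ ^ 2 → (p 2 ≠ 0 ∨ p 3 ≠ 0) →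
            ηH p = ι (χ (WithLp.toLp 2
              ![p 0, p 1, p 2 / (p 2 ^ 2 + p 3 ^ 2), -(p 3) / (p 2 ^ 2 + p 3 ^ 2)]))) ∧
          (∀ p : E4, p 2 = 0 → p 3 = 0 → ηH p ∉ Set.range ι) ∧
          (∀ p : E4, p 2 ^ 2 + p 3 ^ 2 < R₁⁻¹ ^ 2 → ∀ q : E4,
            JX (ηH p) (mfderiv 𝓘(ℝ, E4) (𝓡 4) ηH p q) =
              mfderiv 𝓘(ℝ, E4) (𝓡 4) ηH p (WithLp.toLp 2 ![-(q 1), q 0, -(q 3), q 2]))) ∧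
        (IsLocalDiffeomorphOn 𝓘(ℝ, E4) (𝓡 4) ∞ ηC
            {p : E4 | p 0 ^ 2 + p 1 ^ 2 < R₁⁻¹ ^ 2 ∧ p 2 ^ 2 + p 3 ^ 2 < R₁⁻¹ ^ 2} ∧
          Set.InjOn ηC {p : E4 | p 0 ^ 2 + p 1 ^ 2 < R₁⁻¹ ^ 2 ∧ p 2 ^ 2 + p 3 ^ 2 < R₁⁻¹ ^ 2} ∧
          (∀ p : E4, p 0 ^ 2 + p 1 ^ 2 < R₁⁻¹ ^ 2 → p 2 ^ 2 + p 3 ^ 2 < R₁⁻¹ ^ 2 →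
            (p 2 ≠ 0 ∨ p 3 ≠ 0) →
            ηC p = ηV (WithLp.toLp 2
              ![p 0, p 1, p 2 / (p 2 ^ 2 + p 3 ^ 2), -(p 3) / (p 2 ^ 2 + p 3 ^ 2)])) ∧
          (∀ p : E4, p 0 ^ 2 + p 1 ^ 2 < R₁⁻¹ ^ 2 → p 2 ^ 2 + p 3 ^ 2 < R₁⁻¹ ^ 2 →
            (p 0 ≠ 0 ∨ p 1 ≠ 0) →
            ηC p = ηH (WithLp.toLp 2
              ![p 0 / (p 0 ^ 2 + p 1 ^ 2), -(p 1) / (p 0 ^ 2 + p 1 ^ 2), p 2, p 3])) ∧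
          ηC 0 ∉ Set.range ι ∧
          (∀ p : E4, p 0 ^ 2 + p 1 ^ 2 < R₁⁻¹ ^ 2 → p 2 ^ 2 + p 3 ^ 2 < R₁⁻¹ ^ 2 → ∀ q : E4,
            JX (ηC p) (mfderiv 𝓘(ℝ, E4) (𝓡 4) ηC p q) =
              mfderiv 𝓘(ℝ, E4) (𝓡 4) ηC p (WithLp.toLp 2 ![-(q 1), q 0, -(q 3), q 2]))) ∧
        (∀ y : X, y ∈ Set.range ι ∨ (∃ p : E4, p 0 ^ 2 + p 1 ^ 2 < R₁⁻¹ ^ 2 ∧ ηV p = y) ∨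
          (∃ p : E4, p 2 ^ 2 + p 3 ^ 2 < R₁⁻¹ ^ 2 ∧ ηH p = y) ∨
          (∃ p : E4, (p 0 ^ 2 + p 1 ^ 2 < R₁⁻¹ ^ 2 ∧ p 2 ^ 2 + p 3 ^ 2 < R₁⁻¹ ^ 2) ∧ ηC p = y)) →
        (∀ p q : E4, p 2 = 0 → p 3 = 0 → q 0 = 0 → q 1 = 0 → ηH p ≠ ηV q) ∧
        (∀ p : E4, p 2 = 0 → p 3 = 0 → ηH p ≠ ηC 0) ∧
        (∀ q : E4, q 0 = 0 → q 1 = 0 → ηV q ≠ ηC 0) := by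
  intro M _ _ _ _ _ _ _J K R R₁ ψ χ _ _ h8 h9 hR hR₁ _ X _ _ _ _ _ _ _ _ωX _JX ι ηH ηV ηC hW
  obtain ⟨-, ⟨-, hι, -⟩, ⟨hVloc, -, hVcap, hVaxis, -⟩, ⟨hHloc, -, hHcap, hHaxis, -⟩,
    ⟨hCloc, -, hCV, hCH, hC0, -⟩, -⟩ := hW
  -- `χ` is injective beyond `R`: it inverts `ψ` there (H8, H9)
  have hψχ : ∀ w : E4, R < ‖w‖ → ψ (χ w) = w := by
    intro w hw
    have hw' : w ∈ (Metric.closedBall (0 : E4) R)ᶜ := by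
      simpa [Metric.mem_closedBall, dist_zero_right] using hw
    obtain ⟨x, hx, rfl⟩ := h8.surjOn hw'
    rw [h9 x hx]
  have hχ : ∀ w w' : E4, R < ‖w‖ → R < ‖w'‖ → χ w = χ w' → w = w' := by
    intro w w' hw hw' h
    calc w = ψ (χ w) := (hψχ w hw).symm
      _ = ψ (χ w') := by rw [h]
      _ = w' := hψχ w' hw'
  -- the three charts are local homeomorphisms on their polydiscs (`IsLocalDiffeomorphOn`)
  refine ⟨fun p q hp2 hp3 hq0 hq1 => ?_, fun p hp2 hp3 => ?_, fun q hq0 hq1 => ?_⟩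
  · exact CapModel.ηH_ne_ηV hR hR₁ hχ hι hVloc.isLocalHomeomorphOn hVcap hVaxis
      hHloc.isLocalHomeomorphOn hHcap hp2 hp3 hq0 hq1
  · exact CapModel.ηH_ne_ηC_zero hR hR₁ hχ hι hVcap hVaxis hHloc.isLocalHomeomorphOn hHcap
      hHaxis hCloc.isLocalHomeomorphOn hCV hCH hC0 hp2 hp3
  · exact CapModel.ηV_ne_ηC_zero hR hR₁ hχ hι hVloc.isLocalHomeomorphOn hVcap hVaxis hHcap
      hHaxis hCloc.isLocalHomeomorphOn hCV hCH hC0 hq0 hq1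

end Summit.SmoothPoincare4.SmoothPoincare4.Theorems.GromovRecognitionRelEnd.CrossCapLaurent

end
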